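import Summits.CriticalPhenomena.PercolationContinuityZ3.Theorems.Transplant.KNStarScheme
import HarnessLib

/-!
# v3′+F1 ENTRY-SEED STAR scheme, generic layer (corrected part 1, supersedes `KNStarScheme`): star geometries with DEEP ENTRY SEEDS and a
# MAJORITY-OF-STRIPS success criterion; the staged probe of one macro-edge and its locality
# (design of record: HOME/ENTRY-SEED-STAR.md + lead ruling 13:07Z = v3′ + p5-g2's F1: one fat deep seed per candidate, exact re-centring at the
# chosen strip vertex's fibre, success = some seed open ∧ at least half of the strips of every onward arrival slab reached from the wired seed)

builds on p205010 (kernel theorem, internal audit signed; external expert review pending) — nothing in this file uses p205010.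
Lane `prim-bschramm`, seat `prim-bschramm-p2` (generic v3′); helper file (`--supports stmt-CriticalPhenomena-4575`).

THE EXAMINATION of `y` along `(x → y)` from an occupied `x` (anchor `γ_x`, wired source set `C_x`, star pattern `P_x`, reached strips `J_x(δ)`):
for each `j ∈ J_x(δ)` the pinned strip vertex `u_j` (a vertex of strip `j` of the arrival slab of `y`, joined to `C_x` inside `Star_x` by `P_x`) carries
the ENTRY SEED `seed u_j δ` (instance: entry edge + inward stalk + the edges of a fat cube `cube u_j δ` at depth `ℓ₀`, all at the fibre of `u_j`);
SUCCESS_E := some seed is fully open (`j*` least); `γ_y := fib u_{j*}`, `C_y := cube u_{j*} δ`; the fresh STAR `Star γ_y y ons` is revealed and `y` is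
OCCUPIED iff SUCCESS_E and, for every onward side `δ′`, at least half of the `N` strips of the arrival slab towards `δ′` are joined inside
`Star ∪ seed` to `C_y` by observed open edges; the reached strips `J_y(δ′)` and the pattern are recorded.  One adaptive probe per macro-edge.
* §1 `Geom V A` (N, root, a₀, fib, `col : Site 2 → Set V`, K, Corr, Aslab, strip, seed, cube), `Star`; `Sch`; `PConnS`, `stripPt`;
* §2 the replayed state `State` (macro-state, anchors, source sets, star patterns, onward sets, reached strips), `U₀`, `F`, `Vx`, `onward`, `sInit`;
* §3 probe data `entryV/seedOf/candA/starOf/seeds/env/eIdx/revealOf/reached/succP` and locality; the probe `probeP : AProbe V`, `succP_read_iff`.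
[cite: KozmaNitzan2024, §4 pp. 25–27 (exploration processes; (1)–(5)), p. 19 (seeds)] [cite: GrimmettPercolation1999, §7.2]
-/

noncomputable section

open MeasureTheory ProbabilityTheory
open scoped ENNReal Classical

namespace Summit.CriticalPhenomena.PercolationContinuityZ3.Theorems

namespace Transplant

namespace StarScheme

open Literature.Probability.Percolation Literature.Probability.LatticeModels SimpleGraph GadgetSystem ProbeHistory HSiteScheme
open KNCells (vspan mem_vspan_iff)
open KNStar (PConn)
open Literature.Probability.Percolation.KozmaNitzan (opens)

variable {V : Type*} [DecidableEq V]

/-! ## §1 Star geometries with deep entry seeds -/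

/-- **Star geometry** (v3′+F1): `N` strips per arrival slab; root, root anchor, fibre coordinate; the column marker of a macro-vertex (a set);
core, corridors, arrival slabs (anchored); strips; the entry seed `seed u δ` of a strip vertex `u` towards `δ` (a finite edge set) and its wired
source set `cube u δ`. [cite: KozmaNitzan2024, §4 pp. 25–26 (cells), p. 19 (seeds)] -/
structure Geom (V A : Type*) where
  /-- number of strips -/
  N : ℕ
  /-- the root vertex -/
  root : V
  /-- the root anchor -/
  a₀ : A
  /-- the fibre coordinate -/
  fib : V → A
  /-- the column marker of a macro-vertex -/
  col : Site 2 → Set V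
  /-- the core of the cell of `v`, anchored -/
  K : A → Site 2 → Finset V
  /-- the corridor from the cell of `v` towards `v + δ`, anchored -/
  Corr : A → Site 2 → MDir → Finset V
  /-- the arrival slab of the cell `v + δ` on the side of `v`, anchored -/
  Aslab : A → Site 2 → MDir → Finset V
  /-- the strips of an arrival slab -/
  strip : A → Site 2 → MDir → Fin N → Finset V
  /-- the entry seed of a strip vertex towards `δ` -/
  seed : V → MDir → Finset (Sym2 V)
  /-- the wired source set of an entry seed -/
  cube : V → MDir → Finset V

namespace Geom

variable {A : Type*} (Γ : Geom V A)

/-- **The star** of the cell of `v` anchored at `γ` with onward directions `ons`. [cite: KozmaNitzan2024, §4 p. 26 (E_{v,x})] -/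
def Star (γ : A) (v : Site 2) (ons : Finset MDir) : Finset V :=
  Γ.K γ v ∪ ons.biUnion fun δ => Γ.Corr γ v δ ∪ Γ.Aslab γ v δ

end Geom

/-- **The scheme data**: a star geometry and the density `p`. [cite: KozmaNitzan2024, §4 p. 25] -/
structure Sch (V A : Type*) where
  /-- the star geometry -/
  Γ : Geom V A
  /-- the density -/
  p : unitInterval

/-- **Pattern connection from a set of sources**: some `u ∈ U` is joined to `t` by the edges of `F`. [folklore] -/
def PConnS (F : Finset (Sym2 V)) (U : Finset V) (t : V) : Prop := ∃ u ∈ U, PConn F u t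

omit [DecidableEq V] in
/-- `PConnS` is monotone in the edge set. [folklore] -/
theorem PConnS.mono {F F' : Finset (Sym2 V)} (h : F ⊆ F') {U : Finset V} {t : V} (ht : PConnS F U t) : PConnS F' U t := by
  obtain ⟨u, hu, hut⟩ := ht; exact ⟨u, hu, hut.mono h⟩

omit [DecidableEq V] in
/-- Extending a connection from the sources by a connection in the pattern. [folklore] -/
theorem PConnS.trans {F : Finset (Sym2 V)} {U : Finset V} {t w : V} (h1 : PConnS F U t) (h2 : PConn F t w) : PConnS F U w := by
  obtain ⟨u, hu, hut⟩ := h1; exact ⟨u, hu, hut.trans h2⟩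

omit [DecidableEq V] in
/-- A source is joined to the sources. [folklore] -/
theorem PConnS.of_mem (F : Finset (Sym2 V)) {U : Finset V} {u : V} (hu : u ∈ U) : PConnS F U u := ⟨u, hu, PConn.refl _ _⟩

namespace Geom

variable {A : Type*} (Γ : Geom V A)

/-- **The pinned strip vertex**: a vertex of the strip `j` joined to one of the sources `U` by the pattern `F` (by choice; the root if there is
none). [cite: KozmaNitzan2024, §4 p. 27] -/
def stripPt (γ : A) (v : Site 2) (δ : MDir) (j : Fin Γ.N) (U : Finset V) (F : Finset (Sym2 V)) : V :=
  if h : ∃ t ∈ Γ.strip γ v δ j, PConnS F U t then Classical.choose h else Γ.root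

omit [DecidableEq V] in
/-- If some strip vertex is joined to the sources, the pinned strip vertex is one. [folklore] -/
theorem stripPt_spec {γ : A} {v : Site 2} {δ : MDir} {j : Fin Γ.N} {U : Finset V} {F : Finset (Sym2 V)}
    (h : ∃ t ∈ Γ.strip γ v δ j, PConnS F U t) :
    Γ.stripPt γ v δ j U F ∈ Γ.strip γ v δ j ∧ PConnS F U (Γ.stripPt γ v δ j U F) := by
  unfold stripPt; rw [dif_pos h]; exact Classical.choose_spec h

end Geom

/-! ## §2 The replayed state -/

/-- **The replayed state**: the macro-state, and for every macro-vertex its anchor, its wired source set, the open pattern of its star, its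
onward directions and, per direction, the set of reached strips (junk off the occupied ones). [cite: KozmaNitzan2024, §4 pp. 25–27] -/
structure State (V A : Type*) (N : ℕ) where
  /-- the macro-state -/
  st : HSiteScheme.HState
  /-- anchors -/
  anc : Site 2 → A
  /-- wired source sets -/
  srcs : Site 2 → Finset V
  /-- open patterns of the stars -/
  pat : Site 2 → Finset (Sym2 V)
  /-- onward directions at examination -/
  ons : Site 2 → Finset MDir
  /-- reached strips, per direction -/
  J : Site 2 → MDir → Finset (Fin N)

namespace Sch

variable {A : Type*} (G : SimpleGraph V) [G.LocallyFinite] (S : Sch V A)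

/-- The initial edges: the edges of `G` inside the root star. [cite: KozmaNitzan2024, §4 p. 27 (G₀ = {0} if all edges of Q_0 are open)] -/
def U₀ : Finset (Sym2 V) := edgesIn G (S.Γ.Star S.Γ.a₀ 0 Finset.univ)

/-- The explored edges after a history. [cite: KozmaNitzan2024, §4 p. 26 (ω|_{E_i})] -/
def F (h : ProbeHistory V) : Finset (Sym2 V) := S.U₀ G ∪ supp h

/-- The explored region. [cite: KozmaNitzan2024, §4 p. 26 (E_i)] -/
def Vx (h : ProbeHistory V) : Finset V := vspan (S.F G h)

/-- **The onward directions** out of `v`: the neighbours whose column marker is unexplored (KN (29)). [cite: KozmaNitzan2024, §4 p. 26 ((29))] -/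
def onward (h : ProbeHistory V) (v : Site 2) : Finset MDir :=
  Finset.univ.filter fun du => ∀ y ∈ S.Vx G h, y ∉ S.Γ.col (v + stepVec du)

/-- The initial replayed state: the root occupied with anchor `a₀`, source set `{root}`, pattern `U₀`, all directions onward, all strips reached.
[folklore] -/
def sInit : State V A S.Γ.N :=
  ⟨HSiteScheme.HState.start, fun _ => S.Γ.a₀, fun _ => {S.Γ.root}, fun _ => S.U₀ G, fun _ => Finset.univ, fun _ _ => Finset.univ⟩

/-! ## §3 The probe after a history -/

variable {G}

/-- The pinned strip vertex `j` of the source `x = e.1` towards `e.2`. [cite: KozmaNitzan2024, §4 p. 27] -/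
def entryV (σ : State V A S.Γ.N) (e : Site 2 × MDir) (j : Fin S.Γ.N) : V :=
  S.Γ.stripPt (σ.anc e.1) e.1 e.2 j (σ.srcs e.1) (σ.pat e.1)

/-- The entry seed of candidate `j`. [folklore] -/
def seedOf (σ : State V A S.Γ.N) (e : Site 2 × MDir) (j : Fin S.Γ.N) : Finset (Sym2 V) := S.Γ.seed (S.entryV σ e j) e.2

/-- The wired source set of candidate `j`. [folklore] -/
def cubeOf (σ : State V A S.Γ.N) (e : Site 2 × MDir) (j : Fin S.Γ.N) : Finset V := S.Γ.cube (S.entryV σ e j) e.2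

/-- The candidate anchor of candidate `j`: the fibre of its strip vertex. [folklore] -/
def candA (σ : State V A S.Γ.N) (e : Site 2 × MDir) (j : Fin S.Γ.N) : A := S.Γ.fib (S.entryV σ e j)

/-- All candidate seeds' edges. [folklore] -/
def seeds (σ : State V A S.Γ.N) (e : Site 2 × MDir) : Finset (Sym2 V) := (σ.J e.1 e.2).biUnion (S.seedOf σ e)

/-- **The least candidate whose seed is fully open**, if any. [folklore] -/
def eIdx (σ : State V A S.Γ.N) (e : Site 2 × MDir) (o : Finset (Sym2 V)) : Option (Fin S.Γ.N) :=
  ((σ.J e.1 e.2).filter fun j => S.seedOf σ e j ⊆ o).min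

variable (G)

/-- The candidate star of candidate `j`. [folklore] -/
def starOf (σ : State V A S.Γ.N) (h : ProbeHistory V) (e : Site 2 × MDir) (j : Fin S.Γ.N) : Finset V :=
  S.Γ.Star (S.candA σ e j) (tgt e) (S.onward G h (tgt e))

/-- **The envelope**: all candidate seeds and the edges of all candidate stars. [cite: KozmaNitzan2024, §4 p. 25 (2)] -/
def env (σ : State V A S.Γ.N) (h : ProbeHistory V) (e : Site 2 × MDir) : Finset (Sym2 V) :=
  S.seeds σ e ∪ (σ.J e.1 e.2).biUnion fun j => edgesIn G (S.starOf G σ h e j)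

/-- The revealed edges as a function of the observation: the seeds, and the chosen star if some seed is open.
[cite: KozmaNitzan2024, §4 p. 27 (adaptive examination)] -/
def revealOf (σ : State V A S.Γ.N) (h : ProbeHistory V) (e : Site 2 × MDir) (o : Finset (Sym2 V)) : Finset (Sym2 V) :=
  S.seeds σ e ∪ match S.eIdx σ e o with
    | none => ∅
    | some j => edgesIn G (S.starOf G σ h e j)

/-- The pattern available to the star paths of candidate `j`: the observed edges inside the star together with the candidate's seed. [folklore] -/
def starPat (σ : State V A S.Γ.N) (h : ProbeHistory V) (e : Site 2 × MDir) (o : Finset (Sym2 V)) (j : Fin S.Γ.N) : Finset (Sym2 V) :=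
  o ∩ (edgesIn G (S.starOf G σ h e j) ∪ S.seedOf σ e j)

/-- **The reached strips** of the onward side `δ'` from the wired source set of candidate `j`. [folklore] -/
def reached (σ : State V A S.Γ.N) (h : ProbeHistory V) (e : Site 2 × MDir) (o : Finset (Sym2 V)) (j : Fin S.Γ.N) (δ' : MDir) :
    Finset (Fin S.Γ.N) :=
  Finset.univ.filter fun j' => ∃ t ∈ S.Γ.strip (S.candA σ e j) (tgt e) δ' j', PConnS (S.starPat G σ h e o j) (S.cubeOf σ e j) t

/-- **Success**: some candidate seed is fully open, and from the wired source set of the least such candidate at least half of the strips of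
every onward arrival slab are reached inside the star. [cite: KozmaNitzan2024, §4 p. 27 ("declare v good …")] -/
def succP (σ : State V A S.Γ.N) (h : ProbeHistory V) (e : Site 2 × MDir) (o : Finset (Sym2 V)) : Prop :=
  ∃ j, S.eIdx σ e o = some j ∧ ∀ δ' ∈ S.onward G h (tgt e), S.Γ.N ≤ 2 * (S.reached G σ h e o j δ').card

/-! ### Locality -/

variable {G S}
variable {σ : State V A S.Γ.N} {h : ProbeHistory V} {e : Site 2 × MDir}

omit [G.LocallyFinite] in
/-- A candidate's seed lies in the seeds. [folklore] -/
theorem seedOf_subset_seeds {j : Fin S.Γ.N} (hj : j ∈ σ.J e.1 e.2) : S.seedOf σ e j ⊆ S.seeds σ e :=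
  Finset.subset_biUnion_of_mem (S.seedOf σ e) hj

omit [G.LocallyFinite] in
/-- The chosen candidate is a candidate. [folklore] -/
theorem mem_J_of_eIdx {o : Finset (Sym2 V)} {j : Fin S.Γ.N} (hj : S.eIdx σ e o = some j) : j ∈ σ.J e.1 e.2 := by
  have := Finset.mem_of_min hj
  exact (Finset.mem_filter.1 this).1

omit [G.LocallyFinite] in
/-- The chosen candidate's seed is open. [folklore] -/
theorem seedOf_subset_of_eIdx {o : Finset (Sym2 V)} {j : Fin S.Γ.N} (hj : S.eIdx σ e o = some j) : S.seedOf σ e j ⊆ o := by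
  have := Finset.mem_of_min hj
  exact (Finset.mem_filter.1 this).2

omit [G.LocallyFinite] in
/-- The entry index depends only on the seeds' status. [folklore] -/
theorem eIdx_congr {o o' : Finset (Sym2 V)} (hag : ∀ x ∈ S.seeds σ e, x ∈ o ↔ x ∈ o') : S.eIdx σ e o = S.eIdx σ e o' := by
  unfold eIdx
  congr 1
  ext j
  simp only [Finset.mem_filter, and_congr_right_iff]
  intro hj
  constructor
  · intro h x hx; exact (hag x (seedOf_subset_seeds hj hx)).1 (h hx)
  · intro h x hx; exact (hag x (seedOf_subset_seeds hj hx)).2 (h hx)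

/-- The seeds are revealed. [folklore] -/
theorem seeds_subset_revealOf (o : Finset (Sym2 V)) : S.seeds σ e ⊆ S.revealOf G σ h e o := Finset.subset_union_left

/-- If candidate `j` is chosen, its star is revealed. [folklore] -/
theorem star_subset_revealOf {o : Finset (Sym2 V)} {j : Fin S.Γ.N} (hj : S.eIdx σ e o = some j) :
    edgesIn G (S.starOf G σ h e j) ⊆ S.revealOf G σ h e o := by
  intro x hx; unfold revealOf; rw [hj]; exact Finset.mem_union_right _ hx

/-- The revealed edges lie in the envelope. [folklore] -/
theorem revealOf_subset_env (o : Finset (Sym2 V)) : S.revealOf G σ h e o ⊆ S.env G σ h e := by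
  intro x hx
  unfold revealOf at hx
  rcases Finset.mem_union.1 hx with hx | hx
  · exact Finset.mem_union_left _ hx
  · cases hj : S.eIdx σ e o with
    | none => rw [hj] at hx; simp at hx
    | some j => rw [hj] at hx; exact Finset.mem_union_right _ (Finset.mem_biUnion.2 ⟨j, mem_J_of_eIdx hj, hx⟩)

/-- **Locality of the reveal.** [folklore] -/
theorem revealOf_congr {o o' : Finset (Sym2 V)} (hag : ∀ x ∈ S.revealOf G σ h e o, x ∈ o ↔ x ∈ o') :
    S.revealOf G σ h e o' = S.revealOf G σ h e o := by
  have hidx : S.eIdx σ e o' = S.eIdx σ e o := (eIdx_congr fun x hx => hag x (seeds_subset_revealOf o hx)).symm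
  unfold revealOf; rw [hidx]

/-- The star pattern of the chosen candidate is the same for observations agreeing on the revealed edges. [folklore] -/
theorem starPat_congr {o o' : Finset (Sym2 V)} (hag : ∀ x ∈ S.revealOf G σ h e o, x ∈ o ↔ x ∈ o') {j : Fin S.Γ.N}
    (hj : S.eIdx σ e o = some j) : S.starPat G σ h e o j = S.starPat G σ h e o' j := by
  have hsub : edgesIn G (S.starOf G σ h e j) ∪ S.seedOf σ e j ⊆ S.revealOf G σ h e o :=
    Finset.union_subset (star_subset_revealOf hj) ((seedOf_subset_seeds (mem_J_of_eIdx hj)).trans (seeds_subset_revealOf o))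
  ext x
  simp only [starPat, Finset.mem_inter]
  constructor
  · rintro ⟨hxo, hxS⟩; exact ⟨(hag x (hsub hxS)).1 hxo, hxS⟩
  · rintro ⟨hxo, hxS⟩; exact ⟨(hag x (hsub hxS)).2 hxo, hxS⟩

/-- So are the reached strips. [folklore] -/
theorem reached_congr {o o' : Finset (Sym2 V)} (hag : ∀ x ∈ S.revealOf G σ h e o, x ∈ o ↔ x ∈ o') {j : Fin S.Γ.N}
    (hj : S.eIdx σ e o = some j) (δ' : MDir) : S.reached G σ h e o j δ' = S.reached G σ h e o' j δ' := by
  unfold reached; rw [starPat_congr hag hj]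

/-- **Locality of success.** [folklore] -/
theorem succP_congr {o o' : Finset (Sym2 V)} (hag : ∀ x ∈ S.revealOf G σ h e o, x ∈ o ↔ x ∈ o') :
    S.succP G σ h e o ↔ S.succP G σ h e o' := by
  have hidx : S.eIdx σ e o' = S.eIdx σ e o := (eIdx_congr fun x hx => hag x (seeds_subset_revealOf o hx)).symm
  unfold succP
  constructor
  · rintro ⟨j, hj, hall⟩
    exact ⟨j, hidx.trans hj, fun δ' hδ' => by rw [← reached_congr hag hj]; exact hall δ' hδ'⟩
  · rintro ⟨j, hj, hall⟩
    have hj' : S.eIdx σ e o = some j := hidx.symm.trans hj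
    exact ⟨j, hj', fun δ' hδ' => by rw [reached_congr hag hj']; exact hall δ' hδ'⟩

variable (G S σ h e)

/-- **The staged probe** of the examination along `e` from the replayed state `σ` after `h`. [cite: KozmaNitzan2024, §4 p. 27] -/
def probeP : AProbe V where
  env := S.env G σ h e
  reveal := fun ω => S.revealOf G σ h e (obs ω (S.env G σ h e))
  reveal_subset := fun ω => revealOf_subset_env _
  reveal_local := by
    intro ω ω' hag
    refine revealOf_congr fun x hx => ?_
    have hxe : x ∈ S.env G σ h e := revealOf_subset_env _ hx
    simp only [mem_obs_iff, hxe, true_and]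
    exact hag x hx

/-- Success read off the probe's observation is success read off the envelope's observation. [folklore] -/
theorem succP_read_iff (ω : BondConfig V) :
    S.succP G σ h e ((S.probeP G σ h e).read ω) ↔ S.succP G σ h e (obs ω (S.env G σ h e)) := by
  refine (succP_congr (o := obs ω (S.env G σ h e)) fun x hx => ?_).symm
  have hxe : x ∈ S.env G σ h e := revealOf_subset_env _ hx
  simp only [AProbe.read, probeP, mem_obs_iff, hxe, hx, true_and]

end Sch

end StarScheme

end Transplant

end Summit.CriticalPhenomena.PercolationContinuityZ3.Theorems

end
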